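import Literature.MathematicalPhysics.QuantumLattice.GrassmannWeightedTruncatedBound
import Literature.MathematicalPhysics.QuantumLattice.GrassmannTruncatedBoundDB
import HarnessLib

/-!
# The decay-weighted `L¹–L^∞` tree bound for DETERMINANT-BOUNDED covariances
# (twin of `GrassmannWeightedTruncatedBound` under `IsGramBounded`)

Topic `MathematicalPhysics/QuantumLattice`.  `GrassmannWeightedTruncatedBound` proves the decay-weighted form of the `n!`-free
`L¹–L^∞` estimate of the truncated expectation of kernel vertices (Benfatto–Giuliani–Mastropietro 2006, (2.66)–(2.80) with the
position-space moment bookkeeping of §3 (3.2)–(3.8): a tree weight `wt` on label sets, `wt`-weighted anchored norms of the vertices,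
`wt`-weighted row and column sums of the lines) for a charged covariance in GRAM form; `GrassmannTruncatedBoundDB` re-runs the
UNWEIGHTED estimate under the hypothesis `IsGramBounded C κ` (implied by Gram form and by the Pedra–Salmhofer determinant bound,
de Siqueira Pedra–Salmhofer 2008, Thm 1.3 / Thm 2.4, which has no temperature-uniform Gram form).  The Gram form is consumed in
exactly one place (`norm_kernel_treeFactor_genProd_le`); this file re-runs the two Gram-dependent theorems of the weighted file
VERBATIM with that single call replaced by its twin `norm_kernel_treeFactor_genProd_le_of_gramBounded`:

* `sum_wt_sum_norm_kernel_treeFactor_le_of_gramBounded` (twin of `sum_wt_sum_norm_kernel_treeFactor_le`);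
* **`sum_wt_norm_kernel_ursellOf_kernelVertex_le_of_gramBounded`** (twin of `sum_wt_norm_kernel_ursellOf_kernelVertex_le`):
  `Σ_{W : W_i = w} wt(W) ‖kernel_r 𝓔ᵀ_C(M_0,…,M_{n-1}) (W)‖ ≤ (r!)⁻¹ N^{(r)} κ^{N - r - 2(n-1)} (∏_v N_v) · λ^{-(n-1)} ∏_ℓ (1 + λ α m m'_ℓ)`
  with `wt`-weighted norms `N_v` and `wt`-weighted row sums `α`.

Used by the scale-`0` first-moment bound (E4)₀ of the K3 engine of the cell gate-hubbard-kl (the scale-`0` covariance on the time grid is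
determinant-bounded, `HubbardCTScaleZeroDetBound`, not Gram-bounded).  Everything is proved; no definition, no named fact.

## Sources

G. Benfatto, A. Giuliani, V. Mastropietro, Ann. Henri Poincaré 7 (2006) 809–898, (2.66)–(2.80), §3 (3.2)–(3.8) [`BenfattoGiulianiMastropietro2006`];
W. de Siqueira Pedra, M. Salmhofer, Comm. Math. Phys. 282 (2008) 797–818, Thm 1.3, Thm 2.4 [`PedraSalmhofer2008`];
G. Gentile, V. Mastropietro, Phys. Rep. 352 (2001) 273–437, §4 [`GentileMastropietro2001`].
-/

noncomputable section

namespace Literature.MathematicalPhysics.QuantumLattice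

open GrassmannAlgebra Finset MvPolynomial Literature.RingTheory.MvPolynomial
open Literature.Probability.LatticeModels Literature.Probability.LatticeModels.BattleFederbush
open Literature.MeasureTheory.Integral
open scoped InnerProductSpace

variable {𝕜 : Type*} [RCLike 𝕜] {Γ : Type*} [Fintype Γ] [DecidableEq Γ] {n : ℕ}
variable (C : Matrix Γ Γ 𝕜) (cl : Γ → Fin n) {deg : Fin n → ℕ} (K : ∀ v : Fin n, (Fin (deg v) → Γ) → 𝕜)
variable {wt : Finset Γ → ℝ}

/-- (Twin of `sum_wt_sum_norm_kernel_treeFactor_le` under `IsGramBounded`.) **One script, weighted** (Benfatto–Giuliani–Mastropietro 2006, (2.77) and §3 for one anchored tree): with the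
output slot `i` pinned at `w` and the tree rooted at `cl w`,
`Σ_{W : W_i = w} wt(W) Σ_Y ∏‖K‖ ‖kernel_r (treeFactor s ψ(flat Y)) (W)‖ ≤ (r!)⁻¹ N^{(r)} κ^{N-r-2k} (∏ N_u) (∏_{ℓ ∈ lines} α m m'_ℓ) ∫ w_s`
with `wt`-weighted norms `N_u` and `wt`-weighted row sums `α`. [cite: BenfattoGiulianiMastropietro2006, (2.77)] -/
theorem sum_wt_sum_norm_kernel_treeFactor_le_of_gramBounded (hwt : IsTreeWeight wt) {κ : ℝ} (hκ : 0 ≤ κ) (hGB : IsGramBounded C κ)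
    (hK : ∀ v Yv, K v Yv ≠ 0 → ∀ j, cl (Yv j) = v) (Nv : Fin n → ℝ) (hN0 : ∀ u, 0 ≤ Nv u)
    (hN : ∀ u (j : Fin (deg u)) (a : Γ), ∑ Yu ∈ univ.filter (fun Yu : Fin (deg u) → Γ => Yu j = a), ‖K u Yu‖ * wt (univ.image Yu) ≤ Nv u)
    {α : ℝ} (hα : 0 ≤ α) (hrow : ∀ ℓ X, ∑ Y, ‖typeRestrict C cl ℓ X Y‖ * wt {X, Y} ≤ α)
    (hcol : ∀ ℓ Y, ∑ X, ‖typeRestrict C cl ℓ X Y‖ * wt {X, Y} ≤ α)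
    {w : Γ} {k : ℕ} (s : Script (cl w) k) (hs : s.Valid) (hcov : univ.image s.y = univ) {r : ℕ} (i : Fin r) :
    ∑ W ∈ univ.filter (fun W : Fin r → Γ => W i = w), wt (univ.image W) * ∑ Ys : (∀ v, Fin (deg v) → Γ), (∏ u, ‖K u (Ys u)‖) *
        ‖kernel 𝕜 (((Script.treeFactor (pairLap 𝕜 C cl) s : laplacianAlgebra 𝕜 C cl) : Module.End 𝕜 (GrassmannAlgebra 𝕜 Γ))
          (genProd 𝕜 (flat Ys))) r W‖ ≤
      ((((r.factorial : ℝ))⁻¹ * ((∑ v, deg v).descFactorial r : ℝ)) * κ ^ ((∑ v, deg v) - (r + 2 * k)) * ∏ u, Nv u) *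
        ((s.lines.map fun ℓ => α * (pairDeg deg ℓ : ℝ)).prod * cubeIntegral (Fin n) ℝ (s.weight ℝ)) := by
  set P := patSet (scriptOps C cl (fun _ : Fin r => w) s) (univ : Finset (Fin (∑ v, deg v))) with hP
  set Iw := cubeIntegral (Fin n) ℝ (s.weight ℝ) with hIw
  set c := ((r.factorial : ℝ))⁻¹ with hc
  set e := (∑ v, deg v) - (r + 2 * k) with he
  set D := (α / 2) ^ k * ∏ u, Nv u with hD
  set preds := List.replicate r (fun _ : Fin (∑ v, deg v) × Fin (∑ v, deg v) => true) ++ s.lines.reverse.map (lapPred deg) with hpreds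
  have hIw0 : 0 ≤ Iw := cubeIntegral_nonneg _ fun t ht => FermionicTree.eval_weight_nonneg s ht
  have hc0 : 0 ≤ c := inv_nonneg.2 (Nat.cast_nonneg _)
  have hD0 : 0 ≤ D := mul_nonneg (pow_nonneg (by positivity) _) (prod_nonneg fun u _ => hN0 u)
  have hG0 : ∀ Ys : ∀ v, Fin (deg v) → Γ, 0 ≤ ∏ u, ‖K u (Ys u)‖ := fun Ys => prod_nonneg fun u _ => norm_nonneg _
  -- the `IsGramBounded` bound per output slot and label family
  have h1 : ∀ (W : Fin r → Γ) (Ys : ∀ v, Fin (deg v) → Γ), wt (univ.image W) * ((∏ u, ‖K u (Ys u)‖) *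
      ‖kernel 𝕜 (((Script.treeFactor (pairLap 𝕜 C cl) s : laplacianAlgebra 𝕜 C cl) : Module.End 𝕜 (GrassmannAlgebra 𝕜 Γ))
        (genProd 𝕜 (flat Ys))) r W‖) ≤
      ∑ π ∈ P, (c * κ ^ e * Iw) * ((∏ u, ‖K u (Ys u)‖) * (wt (univ.image W) * patWeight (flat Ys) (scriptOps C cl W s) π)) := by
    intro W Ys
    have h := norm_kernel_treeFactor_genProd_le_of_gramBounded C cl hκ hGB s hs (flat Ys) W
    rw [patSet_scriptOps_eq C cl W (fun _ => w) s, ← hP, ← hc, ← he, ← hIw] at h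
    refine (mul_le_mul_of_nonneg_left (mul_le_mul_of_nonneg_left h (hG0 Ys)) (hwt.nonneg _)).trans (le_of_eq ?_)
    rw [mul_sum, sum_mul, mul_sum, mul_sum]
    exact sum_congr rfl fun π _ => by ring
  -- the admissible patterns and their count
  have hcount : ((P.filter fun π => stepsOK preds π).card : ℝ) ≤
      (((∑ v, deg v).descFactorial r * (s.lines.reverse.map fun ℓ => 2 * pairDeg deg ℓ).prod : ℕ) : ℝ) := by
    set L : List (DelOp Γ 𝕜 × (Fin (∑ v, deg v) × Fin (∑ v, deg v) → Bool) × (ℕ → ℕ)) :=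
      ((List.ofFn fun _ : Fin r => w).map fun X => (DelOp.ext X, (fun _ => true), id)) ++
        (s.lines.reverse.map fun ℓ => (DelOp.lap (typeRestrict C cl ℓ), lapPred deg ℓ, fun _ => 2 * pairDeg deg ℓ)) with hL
    have hfst : L.map Prod.fst = scriptOps C cl (fun _ : Fin r => w) s := by
      rw [hL, List.map_append, List.map_map, List.map_map, scriptOps]; rfl
    have hpred : L.map (fun x => x.2.1) = preds := by
      rw [hL, hpreds, List.map_append, List.map_map, List.map_map, List.map_ofFn]
      exact congrArg₂ _ (List.ofFn_const _ _) rfl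
    have hbd : L.map (fun x => (x.1, x.2.2)) = ((List.ofFn fun _ : Fin r => w).map fun X => ((DelOp.ext X : DelOp Γ 𝕜), id)) ++
        (s.lines.reverse.map fun ℓ => ((DelOp.lap (typeRestrict C cl ℓ) : DelOp Γ 𝕜), fun _ => 2 * pairDeg deg ℓ)) := by
      rw [hL, List.map_append, List.map_map, List.map_map]; rfl
    have hB : ∀ x ∈ L, ∀ S' : Finset (Fin (∑ v, deg v)), ((DelOp.stepSet S' x.1).filter fun pq => x.2.1 pq).card ≤ x.2.2 S'.card := by
      intro x hx S'
      rw [hL, List.mem_append, List.mem_map, List.mem_map] at hx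
      rcases hx with ⟨X, -, rfl⟩ | ⟨ℓ, -, rfl⟩
      · rw [filter_true_of_mem fun _ _ => rfl, DelOp.card_stepSet_ext]
        exact le_rfl
      · exact card_filter_lapPred_le S' _ ℓ
    have h := card_filter_patSet_le L hB univ
    rw [hfst, hpred, hbd, countBound_append, countBound_exts, countBound_consts, card_univ, Fintype.card_fin] at h
    exact_mod_cast h
  -- the per-line factors
  have hprod : (s.lines.map fun ℓ => α * (pairDeg deg ℓ : ℝ)).prod =
      (α / 2) ^ k * (((s.lines.reverse.map fun ℓ => 2 * pairDeg deg ℓ).prod : ℕ) : ℝ) := by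
    rw [Nat.cast_list_prod, List.map_map, List.map_reverse, List.prod_reverse,
      show (fun ℓ => α * (pairDeg deg ℓ : ℝ)) = fun ℓ => (α / 2) * ((Nat.cast : ℕ → ℝ) ∘ fun ℓ => 2 * pairDeg deg ℓ) ℓ from
        funext fun ℓ => by simp only [Function.comp_apply, Nat.cast_mul, Nat.cast_ofNat]; ring,
      List.prod_map_mul, List.map_const', List.prod_replicate, Script.length_lines]
  calc ∑ W ∈ univ.filter (fun W : Fin r → Γ => W i = w), wt (univ.image W) * ∑ Ys : (∀ v, Fin (deg v) → Γ), (∏ u, ‖K u (Ys u)‖) *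
          ‖kernel 𝕜 (((Script.treeFactor (pairLap 𝕜 C cl) s : laplacianAlgebra 𝕜 C cl) : Module.End 𝕜 (GrassmannAlgebra 𝕜 Γ))
            (genProd 𝕜 (flat Ys))) r W‖
      = ∑ W ∈ univ.filter (fun W : Fin r → Γ => W i = w), ∑ Ys : (∀ v, Fin (deg v) → Γ), wt (univ.image W) * ((∏ u, ‖K u (Ys u)‖) *
          ‖kernel 𝕜 (((Script.treeFactor (pairLap 𝕜 C cl) s : laplacianAlgebra 𝕜 C cl) : Module.End 𝕜 (GrassmannAlgebra 𝕜 Γ))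
            (genProd 𝕜 (flat Ys))) r W‖) := sum_congr rfl fun W _ => mul_sum _ _ _
    _ ≤ ∑ W ∈ univ.filter (fun W : Fin r → Γ => W i = w), ∑ Ys : (∀ v, Fin (deg v) → Γ),
          ∑ π ∈ P, (c * κ ^ e * Iw) * ((∏ u, ‖K u (Ys u)‖) * (wt (univ.image W) * patWeight (flat Ys) (scriptOps C cl W s) π)) :=
        sum_le_sum fun W _ => sum_le_sum fun Ys _ => h1 W Ys
    _ = (c * κ ^ e * Iw) * ∑ π ∈ P, ∑ Ys : (∀ v, Fin (deg v) → Γ), (∏ u, ‖K u (Ys u)‖) *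
          ∑ W ∈ univ.filter (fun W : Fin r → Γ => W i = w), wt (univ.image W) * patWeight (flat Ys) (scriptOps C cl W s) π := by
        rw [mul_sum]
        calc ∑ W ∈ univ.filter (fun W : Fin r → Γ => W i = w), ∑ Ys : (∀ v, Fin (deg v) → Γ),
                ∑ π ∈ P, (c * κ ^ e * Iw) * ((∏ u, ‖K u (Ys u)‖) * (wt (univ.image W) * patWeight (flat Ys) (scriptOps C cl W s) π))
            = ∑ Ys : (∀ v, Fin (deg v) → Γ), ∑ W ∈ univ.filter (fun W : Fin r → Γ => W i = w),
                ∑ π ∈ P, (c * κ ^ e * Iw) * ((∏ u, ‖K u (Ys u)‖) * (wt (univ.image W) * patWeight (flat Ys) (scriptOps C cl W s) π)) := sum_comm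
          _ = ∑ Ys : (∀ v, Fin (deg v) → Γ), ∑ π ∈ P, ∑ W ∈ univ.filter (fun W : Fin r → Γ => W i = w),
                (c * κ ^ e * Iw) * ((∏ u, ‖K u (Ys u)‖) * (wt (univ.image W) * patWeight (flat Ys) (scriptOps C cl W s) π)) :=
              sum_congr rfl fun Ys _ => sum_comm
          _ = ∑ π ∈ P, ∑ Ys : (∀ v, Fin (deg v) → Γ), ∑ W ∈ univ.filter (fun W : Fin r → Γ => W i = w),
                (c * κ ^ e * Iw) * ((∏ u, ‖K u (Ys u)‖) * (wt (univ.image W) * patWeight (flat Ys) (scriptOps C cl W s) π)) := sum_comm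
          _ = _ := sum_congr rfl fun π _ => by
              rw [mul_sum]
              refine sum_congr rfl fun Ys _ => ?_
              rw [mul_sum, mul_sum]
    _ ≤ (c * κ ^ e * Iw) * ∑ π ∈ P, (if stepsOK preds π then 1 else 0) * D :=
        mul_le_mul_of_nonneg_left (sum_le_sum fun π _ => sum_kerProd_sum_wt_patWeight_le C cl K hwt hK Nv hN0 hN hα hrow hcol s hs hcov i π)
          (by positivity)
    _ = (c * κ ^ e * Iw) * (((P.filter fun π => stepsOK preds π).card : ℝ) * D) := by
        rw [← sum_mul, ← sum_boole]
    _ ≤ (c * κ ^ e * Iw) * ((((∑ v, deg v).descFactorial r * (s.lines.reverse.map fun ℓ => 2 * pairDeg deg ℓ).prod : ℕ) : ℝ) * D) :=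
        mul_le_mul_of_nonneg_left (mul_le_mul_of_nonneg_right hcount hD0) (by positivity)
    _ = ((c * ((∑ v, deg v).descFactorial r : ℝ)) * κ ^ e * ∏ u, Nv u) *
          ((s.lines.map fun ℓ => α * (pairDeg deg ℓ : ℝ)).prod * Iw) := by
        rw [hprod, hD, Nat.cast_mul]
        ring

/-! ### The weighted bound -/

/-- (Twin of `sum_wt_norm_kernel_ursellOf_kernelVertex_le` under `IsGramBounded`.) **The decay-weighted `L¹–L^∞` bound for the kernels of the truncated expectation of kernel vertices, determinant-bounded covariance**
(Benfatto–Giuliani–Mastropietro 2006, (2.66)–(2.80) with §3 (3.2)–(3.8); Gentile–Mastropietro 2001, §4): for a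
tree weight `wt` on label sets, a covariance `C` Gram-BOUNDED with constant `κ` (`IsGramBounded`; e.g. a Pedra–Salmhofer determinant-bounded chronological propagator) whose
type restrictions have `wt`-weighted row and column sums at most `α`, even kernel vertices `M_v = Σ K_v ψ(·)`
supported on their clusters with `wt`-weighted anchored `L¹` norms `≤ N_v`, and any `λ > 0`: one output label pinned
and the others summed AGAINST THE WEIGHT OF THE OUTPUT LABEL SET,
`Σ_{W : W_i = w} wt(W) ‖kernel_r 𝓔ᵀ_C(M_0,…,M_{n-1}) (W)‖ ≤
  (r!)⁻¹ N^{(r)} κ^{N - r - 2(n-1)} (∏_v N_v) · λ^{-(n-1)} ∏_ℓ (1 + λ α m m'_ℓ)`.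
[cite: BenfattoGiulianiMastropietro2006, (2.66)-(2.80) and §3 (3.2)-(3.8)] -/
theorem sum_wt_norm_kernel_ursellOf_kernelVertex_le_of_gramBounded (hwt : IsTreeWeight wt) {κ : ℝ} (hκ : 0 ≤ κ) (hGB : IsGramBounded C κ)
    (hm : ∀ v, Even (deg v)) (hK : ∀ v Yv, K v Yv ≠ 0 → ∀ j, cl (Yv j) = v) (Nv : Fin n → ℝ) (hN0 : ∀ u, 0 ≤ Nv u)
    (hN : ∀ u (j : Fin (deg u)) (a : Γ), ∑ Yu ∈ univ.filter (fun Yu : Fin (deg u) → Γ => Yu j = a), ‖K u Yu‖ * wt (univ.image Yu) ≤ Nv u)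
    {α : ℝ} (hα : 0 ≤ α) (hrow : ∀ ℓ X, ∑ Y, ‖typeRestrict C cl ℓ X Y‖ * wt {X, Y} ≤ α)
    (hcol : ∀ ℓ Y, ∑ X, ‖typeRestrict C cl ℓ X Y‖ * wt {X, Y} ≤ α) {lam : ℝ} (hlam : 0 < lam)
    {r : ℕ} (i : Fin r) (w : Γ) :
    ∑ W ∈ univ.filter (fun W : Fin r → Γ => W i = w), wt (univ.image W) *
        ‖kernel 𝕜 ((ursellOf (convMoment 𝕜 C (kernelVertex 𝕜 hm K)) univ : evenPart 𝕜 Γ) : GrassmannAlgebra 𝕜 Γ) r W‖ ≤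
      ((((r.factorial : ℝ))⁻¹ * ((∑ v, deg v).descFactorial r : ℝ)) * κ ^ ((∑ v, deg v) - (r + 2 * (n - 1))) * ∏ u, Nv u) *
        ((lam⁻¹) ^ (n - 1) * ∏ ℓ : Sym2 (Fin n), (1 + lam * (α * (pairDeg deg ℓ : ℝ)))) := by
  have hn : 0 < n := Fin.pos (cl w)
  set A := (((r.factorial : ℝ))⁻¹ * ((∑ v, deg v).descFactorial r : ℝ)) with hA
  have hA0 : 0 ≤ A := mul_nonneg (inv_nonneg.2 (Nat.cast_nonneg _)) (Nat.cast_nonneg _)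
  set y : Sym2 (Fin n) → ℝ := fun ℓ => α * (pairDeg deg ℓ : ℝ) with hy
  have hy0 : ∀ ℓ, 0 ≤ y ℓ := fun ℓ => mul_nonneg hα (Nat.cast_nonneg _)
  have hNv : 0 ≤ ∏ u, Nv u := prod_nonneg fun u _ => hN0 u
  set Wset := univ.filter (fun W : Fin r → Γ => W i = w) with hWset
  -- abbreviation for the script terms
  set T : ∀ k : ℕ, Script (cl w) k → (Fin r → Γ) → (∀ v, Fin (deg v) → Γ) → ℝ := fun k s W Ys =>
    ‖kernel 𝕜 (((Script.treeFactor (pairLap 𝕜 C cl) s : laplacianAlgebra 𝕜 C cl) : Module.End 𝕜 (GrassmannAlgebra 𝕜 Γ))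
      (genProd 𝕜 (flat Ys))) r W‖ with hT
  calc ∑ W ∈ Wset, wt (univ.image W) * ‖kernel 𝕜 ((ursellOf (convMoment 𝕜 C (kernelVertex 𝕜 hm K)) univ : evenPart 𝕜 Γ) : GrassmannAlgebra 𝕜 Γ) r W‖
      ≤ ∑ W ∈ Wset, wt (univ.image W) * ∑ Ys : (∀ v, Fin (deg v) → Γ), (∏ u, ‖K u (Ys u)‖) * ∑ k ∈ range n, ∑ s : Script (cl w) k,
          if s.Valid ∧ univ.image s.y = univ then T k s W Ys else 0 :=
        sum_le_sum fun W _ => mul_le_mul_of_nonneg_left (norm_kernel_ursellOf_kernelVertex_le C cl K hm hK (cl w) r W) (hwt.nonneg _)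
    _ = ∑ k ∈ range n, ∑ s : Script (cl w) k, ∑ W ∈ Wset, wt (univ.image W) * ∑ Ys : (∀ v, Fin (deg v) → Γ),
          (∏ u, ‖K u (Ys u)‖) * (if s.Valid ∧ univ.image s.y = univ then T k s W Ys else 0) := by
        calc ∑ W ∈ Wset, wt (univ.image W) * ∑ Ys : (∀ v, Fin (deg v) → Γ), (∏ u, ‖K u (Ys u)‖) * ∑ k ∈ range n, ∑ s : Script (cl w) k,
                (if s.Valid ∧ univ.image s.y = univ then T k s W Ys else 0)
            = ∑ W ∈ Wset, ∑ k ∈ range n, ∑ s : Script (cl w) k, wt (univ.image W) * ∑ Ys : (∀ v, Fin (deg v) → Γ),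
                (∏ u, ‖K u (Ys u)‖) * (if s.Valid ∧ univ.image s.y = univ then T k s W Ys else 0) :=
              sum_congr rfl fun W _ => by
                calc wt (univ.image W) * ∑ Ys : (∀ v, Fin (deg v) → Γ), (∏ u, ‖K u (Ys u)‖) * ∑ k ∈ range n, ∑ s : Script (cl w) k,
                        (if s.Valid ∧ univ.image s.y = univ then T k s W Ys else 0)
                    = ∑ Ys : (∀ v, Fin (deg v) → Γ), ∑ k ∈ range n, ∑ s : Script (cl w) k,
                        wt (univ.image W) * ((∏ u, ‖K u (Ys u)‖) * (if s.Valid ∧ univ.image s.y = univ then T k s W Ys else 0)) := by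
                      rw [mul_sum]
                      exact sum_congr rfl fun Ys _ => by
                        rw [mul_sum, mul_sum]
                        exact sum_congr rfl fun k _ => by rw [mul_sum, mul_sum]
                  _ = ∑ k ∈ range n, ∑ Ys : (∀ v, Fin (deg v) → Γ), ∑ s : Script (cl w) k,
                        wt (univ.image W) * ((∏ u, ‖K u (Ys u)‖) * (if s.Valid ∧ univ.image s.y = univ then T k s W Ys else 0)) := sum_comm
                  _ = ∑ k ∈ range n, ∑ s : Script (cl w) k, ∑ Ys : (∀ v, Fin (deg v) → Γ),
                        wt (univ.image W) * ((∏ u, ‖K u (Ys u)‖) * (if s.Valid ∧ univ.image s.y = univ then T k s W Ys else 0)) :=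
                      sum_congr rfl fun k _ => sum_comm
                  _ = _ := sum_congr rfl fun k _ => sum_congr rfl fun s _ => by rw [mul_sum]
          _ = ∑ k ∈ range n, ∑ W ∈ Wset, ∑ s : Script (cl w) k, wt (univ.image W) * ∑ Ys : (∀ v, Fin (deg v) → Γ),
                (∏ u, ‖K u (Ys u)‖) * (if s.Valid ∧ univ.image s.y = univ then T k s W Ys else 0) := sum_comm
          _ = _ := sum_congr rfl fun k _ => sum_comm
    _ ≤ ∑ k ∈ range n, ∑ s : Script (cl w) k, (if s.Valid ∧ univ.image s.y = univ then
          (A * κ ^ ((∑ v, deg v) - (r + 2 * k)) * ∏ u, Nv u) * ((s.lines.map y).prod * cubeIntegral (Fin n) ℝ (s.weight ℝ)) else 0) := by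
        refine sum_le_sum fun k _ => sum_le_sum fun s _ => ?_
        split_ifs with h
        · exact sum_wt_sum_norm_kernel_treeFactor_le_of_gramBounded C cl K hwt hκ hGB hK Nv hN0 hN hα hrow hcol s h.1 h.2 i
        · simp
    _ = ∑ s : Script (cl w) (n - 1), (if s.Valid ∧ univ.image s.y = univ then
          (A * κ ^ ((∑ v, deg v) - (r + 2 * (n - 1))) * ∏ u, Nv u) * ((s.lines.map y).prod * cubeIntegral (Fin n) ℝ (s.weight ℝ)) else 0) := by
        rw [sum_eq_single (n - 1)]
        · intro k _ hk
          refine sum_eq_zero fun s _ => if_neg ?_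
          rintro ⟨hs, hcov⟩
          have h := Script.card_image_y s hs
          rw [hcov, card_univ, Fintype.card_fin] at h
          omega
        · intro h
          exact absurd (mem_range.2 (by omega)) h
    _ ≤ (A * κ ^ ((∑ v, deg v) - (r + 2 * (n - 1))) * ∏ u, Nv u) * ∑ s : Script (cl w) (n - 1),
          (if s.Valid then (s.lines.map y).prod * cubeIntegral (Fin n) ℝ (s.weight ℝ) else 0) := by
        rw [mul_sum]
        refine sum_le_sum fun s _ => ?_
        have h0 := Script.prod_mul_weight_nonneg s y hy0
        by_cases hv : s.Valid
        · by_cases hc : univ.image s.y = univ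
          · simp [hv, hc]
          · simp only [hv, hc, and_false, if_false, if_true]
            rw [if_pos hv] at h0
            exact mul_nonneg (mul_nonneg (mul_nonneg hA0 (pow_nonneg hκ _)) hNv) h0
        · simp [hv]
    _ ≤ (A * κ ^ ((∑ v, deg v) - (r + 2 * (n - 1))) * ∏ u, Nv u) * ((lam⁻¹) ^ (n - 1) * ∏ ℓ : Sym2 (Fin n), (1 + lam * y ℓ)) :=
        mul_le_mul_of_nonneg_left (sum_prod_mul_weight_le_of_scale y hy0 (cl w) hlam (by rw [Fintype.card_fin]; omega))
          (mul_nonneg (mul_nonneg hA0 (pow_nonneg hκ _)) hNv)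

end Literature.MathematicalPhysics.QuantumLattice

end
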